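import Summits.FinalStateConjecture.FinalStateConjecture.Theorems.SwallowTheDatumParametricKerrBurialLine
import Literature.Geometry.Lorentzian.AFEndAnnulusPatch
import Literature.Geometry.Lorentzian.AFEndChartEmbedding
import HarnessLib

/-!
# `ParametricKerrBurial`, line `receding-annulus-universal-collar` — stub `stub_transportPatch`
# (crux item stmt-FinalStateConjecture-10052)

The registered stub `stub_transportPatch` of the lead's skeleton (reshape v2), proved verbatim.
Given the receding far-gluing family `G R` (exact isotropic Schwarzschild(`m R`) beyond chart
radius `32R` along the sole end `e`, jointly smooth in `(R, x)`, `m R ≥ ηR`) and the dilated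
collar family `Cfam l` on `ℝ³` (isotropic Schwarzschild(`lμ`) on the annulus `{l < ‖y‖ < 2l}`,
Kerr-shielded beyond radius `2l`, jointly smooth in `(l, y)`), set `l(R) = m R/μ ≥ 32R` and

  `P R := G R` inside / `coord^*(Cfam (l R))` beyond chart radius `5l(R)/4`

(`AFEnd.annulusPatch`, `AFEndAnnulusPatch.lean`: the two prescriptions agree on the annulus
`{5l/4 < ‖coord‖ < 7l/4}` where both are `(1 + mR/2r)⁴δ`, `k = 0`). Then `P R = G R` off
`e.far (32R)`; `P R` is admissible (vacuum by locality of the constraints; its end is the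
transplanted far end of `Cfam (l R)`); `P R` is Kerr-shielded through the chart of `e`
(`Φₑ ∘ φ_C`, same Kerr data: `AFEndChartEmbedding.lean`); and `P` is jointly smooth in `(R, x)`
(near a point inside, `P = G` on a product neighbourhood; near a point far out, `P` is the outer
family `coord^*(Cfam (l R))`, smooth by `BilinFamilyPullback` — continuity of `l` moves the seams
only slightly).

References: the route file `Theses/SwallowTheDatum.lean` (item 10052); Lines/receding-annulus-
universal-collar.md; Corvino 2000, §4; Bartnik 1986, §1; Li–Mei arXiv:2005.01249, Prop. 4.1.
-/

-- the doubled `FinalStateConjecture` path component is the summit/problem naming scheme, not a mistake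
set_option linter.dupNamespace false

noncomputable section

namespace Summit.FinalStateConjecture.FinalStateConjecture.Theorems.SwallowTheDatum.ParametricKerrBurial

open scoped Manifold ContDiff Topology
open Bundle Set Filter Function Metric Literature.Geometry.Lorentzian Literature.Geometry.Manifold

variable {X : Type} [TopologicalSpace X] [ChartedSpace E3 X] [IsManifold (𝓡 3) ∞ X]

/-! ## §1 A located shield on `ℝ³` read through the chart of the end -/

/-- The pullback at `y` along `f` of a field `F` depends on `F` only through `F (f y)`. [folklore] -/
theorem pullbackBilin_congr_apply
    {EN : Type*} [NormedAddCommGroup EN] [NormedSpace ℝ EN] {HN : Type*} [TopologicalSpace HN]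
    {IN : ModelWithCorners ℝ EN HN} {N : Type*} [TopologicalSpace N] [ChartedSpace HN N]
    {EM : Type*} [NormedAddCommGroup EM] [NormedSpace ℝ EM] {HM : Type*} [TopologicalSpace HM]
    {IM : ModelWithCorners ℝ EM HM} {M : Type*} [TopologicalSpace M] [ChartedSpace HM M]
    (f : N → M) {F F' : Π x : M, TangentSpace IM x →L[ℝ] TangentSpace IM x →L[ℝ] ℝ} {y : N}
    (h : F (f y) = F' (f y)) :
    pullbackBilin (I := IM) (I' := IN) f F y = pullbackBilin (I := IM) (I' := IN) f F' y := by
  unfold pullbackBilin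
  rw [h]

/-- **A datum which beyond chart radius `R₁` is the `coord`-pullback of a datum `C` on `ℝ³` that
is Kerr-shielded away from radius `ρ ≥ R₁` is Kerr-shielded** (`e` the sole end): shielding chart
`Φₑ ∘ φ_C`, same Kerr data; `(Φₑ ∘ φ_C)^* h_D = φ_C^*(Φₑ^* h_D) = φ_C^* h_C` since beyond `R₁`,
`Φₑ^*(coord^* h_C) = h_C` (`AFEndChartEmbedding.lean`). [folklore] -/
theorem isKerrShielded_of_far_pullback [Kerr.Facts] (e : AFEnd X) (he : e.IsSoleEnd)
    (D : InitialDataSet (𝓡 3) X) (C : InitialDataSet (𝓡 3) E3) {R₁ ρ : ℝ} (hR₁ : e.R ≤ R₁) (hρ : R₁ ≤ ρ)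
    (hDh : ∀ x ∈ e.far R₁, D.h.inner x = AFEnd.outerField e C.coordH x)
    (hDk : ∀ x ∈ e.far R₁, D.k x = AFEnd.outerField e C.coordK x)
    (hC : IsKerrShieldedAway ρ C) : IsKerrShielded X D := by
  obtain ⟨M, a, r₁, hM, T, φ, ψ, ν, hloc, ha, hrm, hrp, hT, hcpt, hemb, hφs, hψT, hsp, hfun, hmet, hK⟩ := hC
  have hR : ∀ z, e.R < ‖φ z‖ := fun z ↦ lt_of_le_of_lt (hR₁.trans hρ) (hloc z)
  have hfar : ∀ z, e.dataChartExt (φ z) ∈ e.far R₁ := fun z ↦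
    (e.dataChartExt_mem_far_iff (hR z)).2 (lt_of_le_of_lt hρ (hloc z))
  -- the chain rule for the composed chart
  have hchain : ∀ (F : Π x : X, TangentSpace (𝓡 3) x →L[ℝ] TangentSpace (𝓡 3) x →L[ℝ] ℝ)
      (y : Kerr.slice a r₁),
      pullbackBilin (I := 𝓡 3) (I' := 𝓘(ℝ, E3)) (e.dataChartExt ∘ φ) F y =
        pullbackBilin (I := 𝓘(ℝ, E3)) (I' := 𝓘(ℝ, E3)) φ
          (pullbackBilin (I := 𝓡 3) (I' := 𝓘(ℝ, E3)) e.dataChartExt F) y := by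
    intro F y
    have hg : MDifferentiableAt 𝓘(ℝ, E3) (𝓡 3) e.dataChartExt (φ y) :=
      (e.contMDiffAt_dataChartExt (hR y)).mdifferentiableAt (by simp)
    have hf : MDifferentiableAt 𝓘(ℝ, E3) 𝓘(ℝ, E3) φ y := (hφs y).mdifferentiableAt (by simp)
    exact pullbackBilin_comp_apply' hg hf F
  refine ⟨M, a, r₁, hM, T, e.dataChartExt ∘ φ, ψ, ν, ha, hrm, hrp, hT,
    e.isCompact_compl_range_dataChartExt_comp he hemb hR hcpt, e.isOpenEmbedding_dataChartExt_comp hemb hR,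
    e.contMDiff_dataChartExt_comp hφs hR, hψT, hsp, hfun, fun y ↦ ?_, fun y ↦ ?_⟩
  · rw [hchain, ← hmet y]
    refine pullbackBilin_congr_apply φ ?_
    exact e.pullbackBilin_dataChartExt_apply_of_eq (hR y) (hDh _ (hfar y))
  · rw [hchain, ← hK y]
    congr 1
    refine pullbackBilin_congr_apply φ ?_
    exact e.pullbackBilin_dataChartExt_apply_of_eq (hR y) (hDk _ (hfar y))

/-! ## §2 The stub -/

/-- **Stub `stub_transportPatch`** (registered signature, line `receding-annulus-universal-collar`,
crux item stmt-FinalStateConjecture-10052): patch the receding far-gluing family with the dilated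
collar family across the isotropic Schwarzschild annulus, `l(R) = m R/μ`. [folklore] -/
theorem stub_transportPatch : ∀ [Kerr.Facts] (X : Type) [TopologicalSpace X] [ChartedSpace E3 X]
    [IsManifold (𝓡 3) ∞ X] [T2Space X] [SecondCountableTopology X] [ConnectedSpace X] (e : AFEnd X)
    (Rstar η μ : ℝ) (m : ℝ → ℝ) (G : ℝ → InitialDataSet (𝓡 3) X) (Cfam : ℝ → InitialDataSet (𝓡 3) E3),
    e.IsSoleEnd → e.R < Rstar → 0 < μ → 32 * μ ≤ η → ContDiff ℝ ∞ m →
    SmoothSectionsOn 𝓘(ℝ, ℝ) G {p : ℝ × X | Rstar < p.1} →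
    (∀ R : ℝ, Rstar < R → G R ∈ admissibleVacuumData X ∧ η * R ≤ m R ∧
      IsExactSchwarzschildBeyond e (G R) (m R) (32 * R)) →
    SmoothSectionsOn 𝓘(ℝ, ℝ) Cfam {p : ℝ × E3 | 0 < p.1} →
    (∀ l : ℝ, 0 < l → Cfam l ∈ admissibleVacuumData E3 ∧
      (∀ y : E3, l < ‖y‖ → ‖y‖ < 2 * l → (Cfam l).h.inner y =
          (1 + l * μ / (2 * ‖y‖)) ^ 4 • (innerSL ℝ : E3 →L[ℝ] E3 →L[ℝ] ℝ) ∧ (Cfam l).k y = 0) ∧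
      IsKerrShieldedAway (2 * l) (Cfam l)) →
    ∃ P : ℝ → InitialDataSet (𝓡 3) X, SmoothSectionsOn 𝓘(ℝ, ℝ) P {p : ℝ × X | Rstar < p.1} ∧
      ∀ R : ℝ, Rstar < R → P R ∈ admissibleVacuumData X ∧ IsKerrShielded X (P R) ∧
        ∀ x ∉ e.far (32 * R), AgreeAt (P R) (G R) x := by
  intro _ X _ _ _ _ _ _ e Rstar η μ m G Cfam he heR hμ h32 hm hGs hG hCs hC
  classical
  -- the collar scale `l(R) = m R / μ ≥ 32 R`
  let l : ℝ → ℝ := fun R ↦ m R / μ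
  have hlμ : ∀ R, l R * μ = m R := fun R ↦ div_mul_cancel₀ (m R) hμ.ne'
  have hl32 : ∀ {R : ℝ}, Rstar < R → 32 * R ≤ l R := by
    intro R hR
    have h1 := (hG R hR).2.1
    rw [le_div_iff₀ hμ]
    nlinarith [e.R_pos]
  have hRpos : ∀ {R : ℝ}, Rstar < R → 0 < R := fun hR ↦ by linarith [e.R_pos]
  have hlpos : ∀ {R : ℝ}, Rstar < R → 0 < l R := fun hR ↦ by linarith [hl32 hR, hRpos hR]
  have hlcont : Continuous l := (hm.continuous).div_const μ
  -- the annulus patch data at each radius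
  have hA : ∀ {R : ℝ}, Rstar < R → AFEnd.AnnulusPatchData e (G R) (Cfam (l R)) (32 * R) (l R) (m R) := by
    intro R hR
    refine ⟨by linarith [hRpos hR], hl32 hR, hlpos hR, (hG R hR).2.2, fun y h1 h2 ↦ ?_⟩
    have h := ((hC (l R) (hlpos hR)).2.1 y h1 h2)
    rwa [hlμ R] at h
  -- the family
  let P : ℝ → InitialDataSet (𝓡 3) X := fun R ↦
    if h : Rstar < R then AFEnd.annulusPatch (hA h) else G R
  have hP : ∀ {R : ℝ} (h : Rstar < R), P R = AFEnd.annulusPatch (hA h) := fun h ↦ dif_pos h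
  -- pointwise values of the sections of `P`
  have hPfar : ∀ {R : ℝ} (h : Rstar < R) {x : X}, x ∈ e.far (5 / 4 * l R) →
      (P R).h.inner x = AFEnd.outerField e ((Cfam (l R)).coordH) x ∧
        (P R).k x = AFEnd.outerField e ((Cfam (l R)).coordK) x := by
    intro R h x hx
    rw [hP h]
    exact AFEnd.annulusPatch_eq_of_mem_far (hA h) hx
  have hPin : ∀ {R : ℝ} (h : Rstar < R) {x : X}, x ∉ e.closedFar (7 / 4 * l R) →
      (P R).h.inner x = (G R).h.inner x ∧ (P R).k x = (G R).k x := by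
    intro R h x hx
    rw [hP h]
    exact ⟨AFEnd.patch_h_inner_of_not_mem_closedFar (AFEnd.annulusPatchData (hA h)) hx,
      AFEnd.patch_k_of_not_mem_closedFar (AFEnd.annulusPatchData (hA h)) hx⟩
  refine ⟨P, ?_, fun R hR ↦ ⟨?_, ?_, fun x hx ↦ ?_⟩⟩
  · /- joint smoothness on `{R⋆ < R}`: near `(R, x)` with `x` inside, `P = G` on a product
      neighbourhood; with `x` far out, `P` is the outer family. -/
    -- the collar family as a smooth matrix-valued function of `(l, z)`
    have hopenE : IsOpen {p : ℝ × E3 | 0 < p.1} := isOpen_lt continuous_const continuous_fst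
    have hCh : ContMDiffOn (𝓘(ℝ, ℝ).prod 𝓘(ℝ, E3)) 𝓘(ℝ, E3 →L[ℝ] E3 →L[ℝ] ℝ) ∞
        (fun p : ℝ × E3 ↦ (Cfam p.1).coordH p.2) {p : ℝ × E3 | 0 < p.1} :=
      ((contMDiffOn_bilinSection_model_iff (IQ := 𝓘(ℝ, ℝ).prod 𝓘(ℝ, E3)) (b := fun p : ℝ × E3 ↦ p.2)
        (s := fun p : ℝ × E3 ↦ (Cfam p.1).coordH p.2) hopenE).1 hCs.1).2
    have hCk : ContMDiffOn (𝓘(ℝ, ℝ).prod 𝓘(ℝ, E3)) 𝓘(ℝ, E3 →L[ℝ] E3 →L[ℝ] ℝ) ∞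
        (fun p : ℝ × E3 ↦ (Cfam p.1).coordK p.2) {p : ℝ × E3 | 0 < p.1} :=
      ((contMDiffOn_bilinSection_model_iff (IQ := 𝓘(ℝ, ℝ).prod 𝓘(ℝ, E3)) (b := fun p : ℝ × E3 ↦ p.2)
        (s := fun p : ℝ × E3 ↦ (Cfam p.1).coordK p.2) hopenE).1 hCs.2).2
    have hopen : IsOpen {p : ℝ × X | Rstar < p.1} := isOpen_lt continuous_const continuous_fst
    -- generic argument for one of the two sections
    have key : ∀ (secP secG : Π q : ℝ × X, TangentSpace (𝓡 3) q.2 →L[ℝ] TangentSpace (𝓡 3) q.2 →L[ℝ] ℝ)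
        (fld : InitialDataSet (𝓡 3) E3 → E3 → E3 →L[ℝ] E3 →L[ℝ] ℝ),
        ContMDiffOn (𝓘(ℝ, ℝ).prod (𝓡 3)) ((𝓡 3).prod 𝓘(ℝ, E3 →L[ℝ] E3 →L[ℝ] ℝ)) ∞
          (fun q : ℝ × X ↦ TotalSpace.mk' (E3 →L[ℝ] E3 →L[ℝ] ℝ)
            (E := fun x : X ↦ TangentSpace (𝓡 3) x →L[ℝ] TangentSpace (𝓡 3) x →L[ℝ] ℝ) q.2 (secG q))
          {p : ℝ × X | Rstar < p.1} →
        ContMDiffOn (𝓘(ℝ, ℝ).prod 𝓘(ℝ, E3)) 𝓘(ℝ, E3 →L[ℝ] E3 →L[ℝ] ℝ) ∞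
          (fun p : ℝ × E3 ↦ fld (Cfam p.1) p.2) {p : ℝ × E3 | 0 < p.1} →
        (∀ q : ℝ × X, Rstar < q.1 → q.2 ∈ e.far (5 / 4 * l q.1) →
          secP q = AFEnd.outerField e (fld (Cfam (l q.1))) q.2) →
        (∀ q : ℝ × X, Rstar < q.1 → q.2 ∉ e.closedFar (7 / 4 * l q.1) → secP q = secG q) →
        ContMDiffOn (𝓘(ℝ, ℝ).prod (𝓡 3)) ((𝓡 3).prod 𝓘(ℝ, E3 →L[ℝ] E3 →L[ℝ] ℝ)) ∞
          (fun q : ℝ × X ↦ TotalSpace.mk' (E3 →L[ℝ] E3 →L[ℝ] ℝ)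
            (E := fun x : X ↦ TangentSpace (𝓡 3) x →L[ℝ] TangentSpace (𝓡 3) x →L[ℝ] ℝ) q.2 (secP q))
          {p : ℝ × X | Rstar < p.1} := by
      intro secP secG fld hGsec hfld hfar hin q hq
      obtain ⟨R, x⟩ := q
      have hR : Rstar < R := hq
      apply ContMDiffAt.contMDiffWithinAt
      -- a neighbourhood of `R` on which `l` moves by less than `l R / 8`
      have hl8 : 0 < l R / 8 := by linarith [hlpos hR]
      obtain ⟨δ, hδ, hδl⟩ := Metric.continuousAt_iff.1 hlcont.continuousAt (l R / 8) hl8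
      set N : Set ℝ := ball R δ ∩ Ioi Rstar with hN
      have hNopen : IsOpen N := isOpen_ball.inter isOpen_Ioi
      have hRN : R ∈ N := ⟨mem_ball_self hδ, hR⟩
      have hNl : ∀ R' ∈ N, |l R' - l R| < l R / 8 := fun R' hR' ↦ by
        have h := hδl hR'.1
        rwa [Real.dist_eq] at h
      set ρ' : ℝ := 3 / 2 * l R with hρ'
      by_cases hx : x ∈ e.closedFar ρ'
      · -- far out: `P = ` the outer family on `N × far (45/32 · l R)`
        obtain ⟨hxU, hxρ⟩ := hx
        have hxfar : x ∈ e.far (45 / 32 * l R) :=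
          e.mem_far_iff_coord.2 ⟨hxU, by linarith [hlpos hR]⟩
        -- the outer family is smooth at `(R, x)`
        have hc : ContMDiffAt (𝓘(ℝ, ℝ).prod 𝓘(ℝ, E3)) 𝓘(ℝ, E3 →L[ℝ] E3 →L[ℝ] ℝ) ∞
            (uncurry fun (R' : ℝ) (z : E3) ↦ fld (Cfam (l R')) z) (R, e.coord x) := by
          have h1 : ContMDiffAt (𝓘(ℝ, ℝ).prod 𝓘(ℝ, E3)) 𝓘(ℝ, E3 →L[ℝ] E3 →L[ℝ] ℝ) ∞
              (fun p : ℝ × E3 ↦ fld (Cfam p.1) p.2) (l R, e.coord x) :=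
            (hfld _ (hlpos hR)).contMDiffAt (hopenE.mem_nhds (hlpos hR))
          have h2 : ContMDiffAt (𝓘(ℝ, ℝ).prod 𝓘(ℝ, E3)) (𝓘(ℝ, ℝ).prod 𝓘(ℝ, E3)) ∞
              (fun p : ℝ × E3 ↦ (l p.1, p.2)) (R, e.coord x) :=
            ((hm.div_const μ).contMDiff.contMDiffAt.comp _ contMDiffAt_fst).prodMk contMDiffAt_snd
          exact h1.comp (R, e.coord x) h2
        have hsm := e.contMDiffAt_outerField_family (IP := 𝓘(ℝ, ℝ)) (c := fun (R' : ℝ) (z : E3) ↦ fld (Cfam (l R')) z)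
          hxU hc
        refine hsm.congr_of_eventuallyEq ?_
        have hev : ∀ᶠ q : ℝ × X in 𝓝 (R, x), q.1 ∈ N ∧ q.2 ∈ e.far (45 / 32 * l R) :=
          prod_mem_nhds (hNopen.mem_nhds hRN) ((e.isOpen_far _).mem_nhds hxfar)
        filter_upwards [hev] with q hq
        have hq1 : Rstar < q.1 := hq.1.2
        have hql := abs_lt.1 (hNl q.1 hq.1)
        have hq2 : q.2 ∈ e.far (5 / 4 * l q.1) := by
          refine e.far_mono ?_ hq.2
          linarith
        rw [hfar q hq1 hq2]
      · -- inside: `P = G` on `N × (closedFar ρ')ᶜ`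
        have hρ'R : e.R < ρ' := by
          have := hl32 hR; have := hRpos hR; rw [hρ']; linarith [heR, e.R_pos]
        have hGat : ContMDiffAt (𝓘(ℝ, ℝ).prod (𝓡 3)) ((𝓡 3).prod 𝓘(ℝ, E3 →L[ℝ] E3 →L[ℝ] ℝ)) ∞
            (fun q : ℝ × X ↦ TotalSpace.mk' (E3 →L[ℝ] E3 →L[ℝ] ℝ)
              (E := fun x : X ↦ TangentSpace (𝓡 3) x →L[ℝ] TangentSpace (𝓡 3) x →L[ℝ] ℝ) q.2 (secG q)) (R, x) :=
          (hGsec _ hR).contMDiffAt (hopen.mem_nhds hR)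
        refine hGat.congr_of_eventuallyEq ?_
        have hev : ∀ᶠ q : ℝ × X in 𝓝 (R, x), q.1 ∈ N ∧ q.2 ∉ e.closedFar ρ' :=
          prod_mem_nhds (hNopen.mem_nhds hRN) ((e.isClosed_closedFar hρ'R).isOpen_compl.mem_nhds hx)
        filter_upwards [hev] with q hq
        have hq1 : Rstar < q.1 := hq.1.2
        have hql := abs_lt.1 (hNl q.1 hq.1)
        have hq2 : q.2 ∉ e.closedFar (7 / 4 * l q.1) := by
          intro hmem
          obtain ⟨hU, hle⟩ := hmem
          exact hq.2 ⟨hU, by linarith⟩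
        rw [hin q hq1 hq2]
    refine ⟨key (fun q ↦ (P q.1).h.inner q.2) (fun q ↦ (G q.1).h.inner q.2) InitialDataSet.coordH hGs.1 hCh
        (fun q h hx ↦ (hPfar h hx).1) (fun q h hx ↦ (hPin h hx).1),
      key (fun q ↦ (P q.1).k q.2) (fun q ↦ (G q.1).k q.2) InitialDataSet.coordK hGs.2 hCk
        (fun q h hx ↦ (hPfar h hx).2) (fun q h hx ↦ (hPin h hx).2)⟩
  · -- admissibility
    rw [hP hR]
    obtain ⟨hGadm, -, -⟩ := hG R hR
    have hGvac : ∀ [(G R).metric.HasLeviCivita], (G R).IsVacuumConstraintSolution := fun {inst} ↦ (hGadm.1).1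
    exact AFEnd.annulusPatch_mem_admissibleVacuumData (hA hR) he hGvac (hC (l R) (hlpos hR)).1
  · -- shielding, read through the chart of the end
    have h54 : e.R ≤ 5 / 4 * l R := by linarith [hl32 hR, hRpos hR, heR]
    refine isKerrShielded_of_far_pullback e he (P R) (Cfam (l R)) h54 (by linarith [hlpos hR])
      (fun x hx ↦ (hPfar hR hx).1) (fun x hx ↦ (hPfar hR hx).2) (hC (l R) (hlpos hR)).2.2
  · -- agreement with `G R` off `e.far (32 R)`
    have hx' : x ∉ e.far (5 / 4 * l R) := fun h ↦ hx (e.far_mono (by linarith [hl32 hR, hRpos hR]) h)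
    rw [hP hR]
    exact AFEnd.annulusPatch_eq_of_not_mem_far (hA hR) hx'

end Summit.FinalStateConjecture.FinalStateConjecture.Theorems.SwallowTheDatum.ParametricKerrBurial

end
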